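import Mathlib.FieldTheory.AbsoluteGaloisGroup
import Literature.AlgebraicGeometry.Motives.Varieties
import Literature.AlgebraicGeometry.Motives.EtalePullbackComp
import HarnessLib

/-!
# The Galois action on the étale cohomology of the geometric fibre (Deligne, Weil I (1.15))

For a scheme `X` over a field `k` with algebraic closure `k̄ = AlgebraicClosure k`, the Galois
group `Gal(k̄/k) = Field.absoluteGaloisGroup k` acts on the geometric fibre
`X_{k̄} = X ×_k Spec k̄` through the second factor, `g ↦ 1 × Spec(g)`, and hence — étale
cohomology with constant coefficients being a contravariant functor (`etaleCohomologyMap`,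
`etaleCohomologyMap_comp`, `etaleCohomologyMap_id` of `EtalePullback(Comp).lean`) — on
`Hⁿ((X_{k̄})_et, M)` for every abelian group `M`. Deligne, *La conjecture de Weil. I*, (1.15)
(journal p. 279): "Tout `F_q`-isomorphisme `σ : F̄₁ → F̄₂` induit un isomorphisme
`Hⁱ_c(X₁, F₁) → Hⁱ_c(X₂, F₂)`. En particulier, pour `F̄₁ = F̄₂`, on trouve que `Gal(F̄/F_q)` agit sur
`Hⁱ_c(X, F)` (action par transport de structure)." This file constructs that action (over any
field `k`, for `Hⁿ` with constant coefficients on the small étale site):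

* `geometricFibre k X = X ×_{Spec k} Spec k̄` (literally Mathlib's `pullback`; it is the underlying
  scheme of `(baseChange k k̄).obj X` by `rfl`, `geometricFibre_eq`);
* `geometricFibreMap X g = 1 × Spec(g) : X_{k̄} → X_{k̄}` with `geometricFibreMap_one`,
  `geometricFibreMap_mul` (`1 × Spec(gh) = (1 × Spec g) ≫ (1 × Spec h)`: a *right* action, `Spec`
  being contravariant), `geometricFibreMap_fst`/`_snd` (it is an `X`-morphism lying over
  `Spec(g)`, i.e. `k̄`-semilinear) and naturality in `X` (`geometricFibreMap_comp_geometricFibreHom`, with `geometricFibreHom φ = (φ_{k̄} : X_{k̄} → X'_{k̄})`);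
* `geometricEtaleCohomologyRep X M n : Gal(k̄/k) →* AddMonoid.End (Hⁿ((X_{k̄})_et, M))`,
  `ρ(g) = (1 × Spec g)^*` — a **group homomorphism** (proved, from the functoriality of `Hⁿ`),
  commuting with change of coefficients (`geometricEtaleCohomologyRep_map`, e.g. with the
  transition maps of the `ℓ`-adic tower) and with pull-backs along `k`-morphisms
  (`geometricEtaleCohomologyRep_pullback`: pull-backs are Galois equivariant).

## References

* P. Deligne, *La conjecture de Weil. I*, Publ. Math. IHÉS 43 (1974), (1.15) p. 279 (the Galois
  action "par transport de structure"; the dictionary `F^* = φ⁻¹`). [Deligne1974]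
* J. S. Milne, *Étale cohomology* (reissue 2025), III Rem. 1.6 (c) (functoriality of `Hⁱ`).
  [Milne2025]

## Design notes

* The representation is valued in `AddMonoid.End` of the cohomology group (coefficients `Ab`);
  module structures (`ℤ/ℓᵐ`, `ℤ_ℓ` on the limit) and continuity of the action are not treated here.
* What is NOT here: the `ℓ`-adic limit (see `EllAdicEtalePullback.lean`), the comparison of
  `ρ(φ)` with the Frobenius endomorphism (Deligne (1.15.1) `F^* = φ⁻¹`, which needs "absolute
  Frobenius acts trivially on the étale site"), smoothness/continuity of `ρ`.
-/

universe u

open CategoryTheory CategoryTheory.Limits AlgebraicGeometry Opposite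

namespace Literature.AlgebraicGeometry.Motives

variable (k : Type u) [Field k] (X : SchemeOver k)

/-- The geometric fibre `X_{k̄} = X ×_k Spec k̄` (`k̄ = AlgebraicClosure k`) of a `k`-scheme, as a
scheme: the underlying scheme of `(baseChange k k̄).obj X`. [folklore] -/
noncomputable abbrev geometricFibre : Scheme.{u} :=
  pullback X.hom (Spec.map (CommRingCat.ofHom (algebraMap k (AlgebraicClosure k))))

/-- `X_{k̄}` is the underlying scheme of the base change `(baseChange k k̄).obj X` (by `rfl`).
[folklore] -/
theorem geometricFibre_eq :
    geometricFibre k X = ((baseChange k (AlgebraicClosure k)).obj X).left :=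
  rfl

variable {k}

/-- The **action of `Gal(k̄/k)` on the geometric fibre**: `g ∈ Gal(k̄/k)` acts on
`X_{k̄} = X ×_k Spec k̄` by `1 × Spec(g)` (a `k̄`-semilinear automorphism of schemes; Deligne,
Weil I (1.15): "transport de structure"). [folklore] -/
noncomputable def geometricFibreMap (g : Field.absoluteGaloisGroup k) :
    geometricFibre k X ⟶ geometricFibre k X :=
  pullback.map _ _ _ _ (𝟙 X.left)
    (Spec.map (CommRingCat.ofHom (g : AlgebraicClosure k ≃ₐ[k] AlgebraicClosure k).toRingHom))
    (𝟙 _) (by simp) (by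
      rw [Category.comp_id, ← Spec.map_comp, ← CommRingCat.ofHom_comp]
      congr 2
      exact (g : AlgebraicClosure k ≃ₐ[k] AlgebraicClosure k).toAlgHom.comp_algebraMap.symm)

/-- `1 × Spec(1) = 𝟙`. [folklore] -/
theorem geometricFibreMap_one : geometricFibreMap X 1 = 𝟙 _ := by
  apply pullback.hom_ext
  · rw [Category.id_comp]
    exact (pullback.lift_fst _ _ _).trans (Category.comp_id _)
  · rw [Category.id_comp]
    refine (pullback.lift_snd _ _ _).trans ?_
    rw [show ((1 : Field.absoluteGaloisGroup k) : AlgebraicClosure k ≃ₐ[k]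
      AlgebraicClosure k).toRingHom = RingHom.id _ from rfl, CommRingCat.ofHom_id, Spec.map_id]
    exact Category.comp_id _

/-- `(1 × Spec g) ≫ (1 × Spec h) = 1 × Spec(g h)`: `Spec` is contravariant and `(g h)(x) = g(h(x))`,
so `g ↦ 1 × Spec(g)` is a *right* action on `X_{k̄}` (hence a left action on cohomology).
[folklore] -/
theorem geometricFibreMap_mul (g h : Field.absoluteGaloisGroup k) :
    geometricFibreMap X (g * h) = geometricFibreMap X g ≫ geometricFibreMap X h := by
  apply pullback.hom_ext
  · rw [Category.assoc, show geometricFibreMap X h ≫ pullback.fst _ _ = pullback.fst _ _ ≫ 𝟙 _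
      from pullback.lift_fst _ _ _, Category.comp_id,
      show geometricFibreMap X g ≫ pullback.fst _ _ = pullback.fst _ _ ≫ 𝟙 _
      from pullback.lift_fst _ _ _]
    exact pullback.lift_fst _ _ _
  · rw [Category.assoc, show geometricFibreMap X h ≫ pullback.snd _ _ = pullback.snd _ _ ≫
      Spec.map (CommRingCat.ofHom (h : AlgebraicClosure k ≃ₐ[k] AlgebraicClosure k).toRingHom)
      from pullback.lift_snd _ _ _, ← Category.assoc,
      show geometricFibreMap X g ≫ pullback.snd _ _ = pullback.snd _ _ ≫
      Spec.map (CommRingCat.ofHom (g : AlgebraicClosure k ≃ₐ[k] AlgebraicClosure k).toRingHom)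
      from pullback.lift_snd _ _ _, Category.assoc, ← Spec.map_comp, ← CommRingCat.ofHom_comp]
    exact pullback.lift_snd _ _ _

/-- `1 × Spec(g)` lies over `X`: it commutes with the projection `X_{k̄} → X`. [folklore] -/
@[reassoc]
theorem geometricFibreMap_fst (g : Field.absoluteGaloisGroup k) :
    geometricFibreMap X g ≫ pullback.fst _ _ = pullback.fst _ _ :=
  (pullback.lift_fst _ _ _).trans (Category.comp_id _)

/-- `1 × Spec(g)` lies over `Spec(g) : Spec k̄ → Spec k̄` (it is `k̄`-semilinear, not `k̄`-linear).
[folklore] -/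
@[reassoc]
theorem geometricFibreMap_snd (g : Field.absoluteGaloisGroup k) :
    geometricFibreMap X g ≫ pullback.snd _ _ = pullback.snd _ _ ≫
      Spec.map (CommRingCat.ofHom (g : AlgebraicClosure k ≃ₐ[k] AlgebraicClosure k).toRingHom) :=
  pullback.lift_snd _ _ _

variable {X} in
/-- The map of geometric fibres `φ_{k̄} = φ × 1 : X_{k̄} → X'_{k̄}` induced by a `k`-morphism
`φ : X → X'`: the underlying morphism of `(baseChange k k̄).map φ` (by `rfl`), with its type
written on `geometricFibre`. [folklore] -/
noncomputable def geometricFibreHom {X' : SchemeOver k} (φ : X ⟶ X') :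
    geometricFibre k X ⟶ geometricFibre k X' :=
  ((baseChange k (AlgebraicClosure k)).map φ).left

variable {X} in
/-- `geometricFibreHom φ` is `((baseChange k k̄).map φ).left` (by `rfl`). [folklore] -/
theorem geometricFibreHom_eq {X' : SchemeOver k} (φ : X ⟶ X') :
    geometricFibreHom φ = ((baseChange k (AlgebraicClosure k)).map φ).left :=
  rfl

variable {X} in
/-- `φ_{k̄}` lies over `φ`. [folklore] -/
@[reassoc]
theorem geometricFibreHom_fst {X' : SchemeOver k} (φ : X ⟶ X') :
    geometricFibreHom φ ≫ pullback.fst _ _ = pullback.fst _ _ ≫ φ.left :=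
  pullback.lift_fst _ _ _

variable {X} in
/-- `φ_{k̄}` is a `k̄`-morphism. [folklore] -/
@[reassoc]
theorem geometricFibreHom_snd {X' : SchemeOver k} (φ : X ⟶ X') :
    geometricFibreHom φ ≫ pullback.snd _ _ = pullback.snd _ _ :=
  pullback.lift_snd _ _ _

variable {X} in
/-- The Galois action on geometric fibres is **natural in the `k`-scheme**: for `φ : X → X'` over
`k`, `(1 × Spec g) ≫ φ_{k̄} = φ_{k̄} ≫ (1 × Spec g)`. [folklore] -/
theorem geometricFibreMap_comp_geometricFibreHom {X' : SchemeOver k} (φ : X ⟶ X')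
    (g : Field.absoluteGaloisGroup k) :
    geometricFibreMap X g ≫ geometricFibreHom φ = geometricFibreHom φ ≫ geometricFibreMap X' g := by
  apply pullback.hom_ext
  · rw [Category.assoc, geometricFibreHom_fst, geometricFibreMap_fst_assoc, Category.assoc,
      geometricFibreMap_fst, geometricFibreHom_fst]
  · rw [Category.assoc, geometricFibreHom_snd, geometricFibreMap_snd, Category.assoc,
      geometricFibreMap_snd, geometricFibreHom_snd_assoc]

/-! ### The Galois representation on `Hⁿ((X_{k̄})_et, M)` -/

section Cohomology

variable (k) (M : Ab.{u}) (n : ℕ)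

/-- **`Hⁿ((X_{k̄})_et, M)`**: étale cohomology of the geometric fibre with constant coefficients
`M` (Mathlib `Sheaf.H` of the constant sheaf on the small étale site). [folklore] -/
noncomputable abbrev geometricEtaleCohomology : Type u :=
  ((constantSheaf (geometricFibre k X).smallEtaleTopology Ab.{u}).obj M).H n

variable {k}

/-- **The Galois representation on the étale cohomology of the geometric fibre**:
`ρ : Gal(k̄/k) →* End(Hⁿ((X_{k̄})_et, M))`, `ρ(g) = (1 × Spec g)^*` ("par transport de structure",
Deligne, Weil I (1.15); Milne VI §13). It is a homomorphism because `g ↦ 1 × Spec g` is a right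
action on `X_{k̄}` and `Hⁿ(–_et, M)` is a contravariant functor (`etaleCohomologyMap_comp`,
`etaleCohomologyMap_id`). [cite: Deligne1974, (1.15)] -/
noncomputable def geometricEtaleCohomologyRep :
    Field.absoluteGaloisGroup k →* AddMonoid.End (geometricEtaleCohomology k X M n) where
  toFun g := etaleCohomologyMap (geometricFibreMap X g) M n
  map_one' := by
    ext x
    change etaleCohomologyMap (geometricFibreMap X 1) M n x = x
    rw [geometricFibreMap_one]
    exact etaleCohomologyMap_id _ M n x
  map_mul' g h := by
    ext x
    change etaleCohomologyMap (geometricFibreMap X (g * h)) M n x =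
      etaleCohomologyMap (geometricFibreMap X g) M n (etaleCohomologyMap (geometricFibreMap X h) M n x)
    rw [geometricFibreMap_mul]
    exact etaleCohomologyMap_comp _ _ M n x

/-- `ρ(g) = (1 × Spec g)^*` (by `rfl`). [folklore] -/
theorem geometricEtaleCohomologyRep_apply (g : Field.absoluteGaloisGroup k)
    (x : geometricEtaleCohomology k X M n) :
    geometricEtaleCohomologyRep X M n g x = etaleCohomologyMap (geometricFibreMap X g) M n x :=
  rfl

/-- The Galois action commutes with change of coefficients `M → N` (e.g. with the transition
maps of the `ℓ`-adic tower `ℤ/ℓᵐ⁺¹ → ℤ/ℓᵐ`). [folklore] -/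
theorem geometricEtaleCohomologyRep_map {M N : Ab.{u}} (a : M ⟶ N) (g : Field.absoluteGaloisGroup k)
    (x : geometricEtaleCohomology k X M n) :
    geometricEtaleCohomologyRep X N n g (Sheaf.H.map ((constantSheaf _ _).map a) n x) =
      Sheaf.H.map ((constantSheaf _ _).map a) n (geometricEtaleCohomologyRep X M n g x) :=
  etaleCohomologyMap_map _ a n x

variable {X} in
/-- **Pull-backs are Galois equivariant**: for `φ : X → X'` over `k`, the pull-back
`φ_{k̄}^* : Hⁿ((X'_{k̄})_et, M) → Hⁿ((X_{k̄})_et, M)` intertwines the Galois actions (naturality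
of `1 × Spec g` in `X` and functoriality of `Hⁿ(–_et, M)`). [folklore] -/
theorem geometricEtaleCohomologyRep_pullback {X' : SchemeOver k} (φ : X ⟶ X')
    (g : Field.absoluteGaloisGroup k) (y : geometricEtaleCohomology k X' M n) :
    geometricEtaleCohomologyRep X M n g (etaleCohomologyMap (geometricFibreHom φ) M n y) =
      etaleCohomologyMap (geometricFibreHom φ) M n (geometricEtaleCohomologyRep X' M n g y) := by
  rw [geometricEtaleCohomologyRep_apply, geometricEtaleCohomologyRep_apply,
    ← etaleCohomologyMap_comp, ← etaleCohomologyMap_comp, geometricFibreMap_comp_geometricFibreHom]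

end Cohomology

end Literature.AlgebraicGeometry.Motives
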